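import Summits.Ventures.LatticeQCDFlow.Scaling.SwapLadderRoundTrip

/-!
HONEST FRAMING: exact (Metropolis-corrected) sampling algorithms for lattice gauge theory; figures
of merit are autocorrelation/cost numbers at stated couplings and volumes; no continuum-physics
claim.

# SwapLadderRoundTripDEO — THE DETERMINISTIC EVEN–ODD SWAP SCHEME (THE ONE ROW 22's DRIVER RUNS): ITS
# LIFTED INDEX WALK CROSSES A `K`-INTERVAL LADDER IN `(K+1) + 2·Σ_i (i+1)·r_i/s_i` SCANS AND MAKES THE
# ROUND TRIP IN `2(K+1) + 2(K+1)·Σ_i r_i/s_i` — THE REVERSIBLE WALK's `2(K+1)·Σ_i 1/a_i` MINUS EXACTLY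
# `2(K+1)(K−1)` (row 22 `su3-ptbc`, GEN-5; our formalisation of a PRINTED formula)

Venture `LatticeQCDFlow` (cell pub-lqcd), topic `Scaling`; FANOUT row 22 (`su3-ptbc`).  PRINTED RESULT, our
kernel-checked derivation from the tree's first-step equations (`IsHittingTimeSolution`, Literature
`RandomTargetLemma`): Syed–Bouchard-Côté–Deligiannidis–Doucet, "Non-reversible parallel tempering", J. R.
Stat. Soc. B 84 (2022) 321 (arXiv:1905.02939), Theorem 1 — under their 'efficient local exploration'
idealisation the index of a replica under the DETERMINISTIC even–odd scheme (DEO; Okabe–Tomita–Higuchi–Yasuda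
2001) performs the LIFTED walk of their App. B on `{0,…,N} × {±}` and `E_DEO[T] = 2(N+1) + 2(N+1)·Σ_i r_i/s_i`,
against `E_SEO[T] = 2(N+1)N + 2(N+1)·Σ_i r_i/s_i` for the stochastic scheme (= `SwapLadderRoundTrip`).
Nothing is cited as a fact: the formula is PROVED here for every acceptance profile.  WHY ROW 22 NEEDS IT:
the driver of record (`HOME/su3-ptbc/code/ptbc/ptbc_lf.py`, `swap_step`) proposes all even pairs, then all
odd pairs, at EVERY call — DEO, one `swap_step` = two scans (a macro-step calls it `Σ n_iter` times under the
hierarchical schedule: P0 `[[2,1,2],[1,2,1]]` ⇒ 6 scans, S2 `[[3,1,2],[1,3,1]]` ⇒ 8 scans per macro-step) — so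
the idealised index dynamics behind CARD §1.6 / GEN-4's `SwapLadderDeliveryTime` is this lifted walk: a
configuration keeps its direction after an accepted swap and reverses it after a rejected one (or at the ends).

The walk `deoWalk K a` on `Fin (K+1) × Bool` (`true` = moving up; bond `i` accepts with `a i = s_i`,
`r_i = 1 − a i`): `(i,↑) → (i+1,↑)` w.p. `a i`, `→ (i,↓)` w.p. `1 − a i` (`i < K`); `(K,↑) → (K,↓)`;
`(i,↓) → (i−1,↓)` w.p. `a (i−1)`, `→ (i,↑)` w.p. `1 − a (i−1)` (`i ≥ 1`); `(0,↓) → (0,↑)`.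
Proved, for EVERY hitting-time solution `h` (targets `⊤ = (K,↑)`, `⊥ = (0,↓)`): `deoWalk_isRowStochastic`;
`deo_down_eq_up_add` (`h(i,↓)⊤ = h(i,↑)⊤ + 2i+1`); `deo_up_step`; **`deo_delivery_time`**
`h ⊥ ⊤ = (K+1) + 2Σ_{i<K}(i+1) r_i/s_i`; `deoWalk_reflect` + **`deo_return_time`**
`h ⊤ ⊥ = (K+1) + 2Σ_{i<K}(K−i) r_i/s_i`; **`deo_round_trip`** `= 2(K+1) + 2(K+1)Σ_i r_i/s_i` (Thm 1, DEO);
**`deo_round_trip_eq_seo_sub`** `= 2(K+1)Σ_i 1/a_i − 2(K+1)(K−1)` — the profile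
enters ONLY through `Σ_i 1/a_i` for both schemes, so `SwapLadderRoundTripOptimum`'s fixed-`K` optimality of the
equal-acceptance ladder holds verbatim for the driver's scheme; `deo_round_trip_const` — flat `a`:
`2(K+1)(1 + K(1−a)/a)` scans (S2's `K = 12`, `a = 0.20`: `2·13·49 = 1274` scans `≈ 159` S2 macro-steps at
8 scans each — a MODEL number for orientation, not an acceptance criterion).
NOT CLAIMED: irreducibility / existence of the hitting-time solution (typed in the sequel
`SwapLadderRoundTripDEOIrreducible`; the statements here hold for every solution, as in the Literature file);
that PTBC satisfies ELE (the card MEASURES round trips); the optimisation over `K` for DEO (sequel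
`SwapSpacingOptimumDEO`); any number of a run.
-/

noncomputable section

open Finset
open Literature.Probability.MarkovChains

namespace Summit.Ventures.LatticeQCDFlow.Scaling

/-! ## §1 The lifted walk -/

section Walk

variable {K : ℕ}

/-- Transition probabilities out of `(i, ↑)`. [ours] -/
def deoFromUp (K : ℕ) (a : ℕ → ℝ) (i : Fin (K + 1)) (y : Fin (K + 1) × Bool) : ℝ :=
  if y.2 = true then (if y.1.val = i.val + 1 then a i.val else 0)
  else (if y.1 = i then (if i.val < K then 1 - a i.val else 1) else 0)
/-- Transition probabilities out of `(i, ↓)`. [ours] -/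
def deoFromDown (K : ℕ) (a : ℕ → ℝ) (i : Fin (K + 1)) (y : Fin (K + 1) × Bool) : ℝ :=
  if y.2 = true then (if y.1 = i then (if i.val = 0 then 1 else 1 - a (i.val - 1)) else 0)
  else (if i.val = y.1.val + 1 then a y.1.val else 0)

/-- **The lifted (DEO) index walk** of a `K`-interval ladder with acceptance profile `a`. [ours] -/
def deoWalk (K : ℕ) (a : ℕ → ℝ) : Matrix (Fin (K + 1) × Bool) (Fin (K + 1) × Bool) ℝ :=
  Matrix.of fun x y => if x.2 = true then deoFromUp K a x.1 y else deoFromDown K a x.1 y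

variable (a : ℕ → ℝ)

/-- `(i,↑) → (j,↑)`: `a i` if `j = i+1`, else `0`. [ours] -/
theorem deoWalk_up_up (i j : Fin (K + 1)) :
    deoWalk K a (i, true) (j, true) = if j.val = i.val + 1 then a i.val else 0 := by
  simp [deoWalk, deoFromUp]
/-- `(i,↑) → (j,↓)`: `1 − a i` (`i < K`) or `1` (`i = K`) if `j = i`, else `0`. [ours] -/
theorem deoWalk_up_down (i j : Fin (K + 1)) :
    deoWalk K a (i, true) (j, false) = if j = i then (if i.val < K then 1 - a i.val else 1) else 0 := by
  simp [deoWalk, deoFromUp]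
/-- `(i,↓) → (j,↑)`: `1 − a (i−1)` (`i ≥ 1`) or `1` (`i = 0`) if `j = i`, else `0`. [ours] -/
theorem deoWalk_down_up (i j : Fin (K + 1)) :
    deoWalk K a (i, false) (j, true) = if j = i then (if i.val = 0 then 1 else 1 - a (i.val - 1)) else 0 := by
  simp [deoWalk, deoFromDown]
/-- `(i,↓) → (j,↓)`: `a j` if `i = j+1`, else `0`. [ours] -/
theorem deoWalk_down_down (i j : Fin (K + 1)) :
    deoWalk K a (i, false) (j, false) = if i.val = j.val + 1 then a j.val else 0 := by
  simp [deoWalk, deoFromDown]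

/-- Row of `(i,↑)`, `i < K`, against a function: `a_i·f(i+1,↑) + (1 − a_i)·f(i,↓)`. [ours] -/
theorem sum_deoWalk_up (f : Fin (K + 1) × Bool → ℝ) (i : Fin (K + 1)) (hi : i.val < K) :
    ∑ y, deoWalk K a (i, true) y * f y
      = a i.val * f (⟨i.val + 1, Nat.succ_lt_succ hi⟩, true) + (1 - a i.val) * f (i, false) := by
  rw [Fintype.sum_prod_type]
  simp only [Fintype.sum_bool, deoWalk_up_up, deoWalk_up_down, sum_add_distrib, ite_mul, zero_mul]
  have h1 : ∑ j : Fin (K + 1), (if j.val = i.val + 1 then a i.val * f (j, true) else 0)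
      = a i.val * f (⟨i.val + 1, Nat.succ_lt_succ hi⟩, true) := by
    rw [Finset.sum_eq_single ⟨i.val + 1, Nat.succ_lt_succ hi⟩ (fun j _ hj => if_neg fun h => hj (Fin.ext h))
      (fun h => absurd (mem_univ _) h), if_pos rfl]
  have h2 : ∑ j : Fin (K + 1), (if j = i then (if i.val < K then (1 - a i.val) * f (j, false) else 1 * f (j, false))
      else 0) = (1 - a i.val) * f (i, false) := by
    rw [Finset.sum_ite_eq' univ i, if_pos (mem_univ _), if_pos hi]
  rw [h1, h2]

/-- Row of the top state `(K,↑)`: `f(K,↓)`. [ours] -/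
theorem sum_deoWalk_top (f : Fin (K + 1) × Bool → ℝ) (i : Fin (K + 1)) (hi : ¬ i.val < K) :
    ∑ y, deoWalk K a (i, true) y * f y = f (i, false) := by
  rw [Fintype.sum_prod_type]
  simp only [Fintype.sum_bool, deoWalk_up_up, deoWalk_up_down, sum_add_distrib, ite_mul, zero_mul]
  have h1 : ∑ j : Fin (K + 1), (if j.val = i.val + 1 then a i.val * f (j, true) else 0) = 0 :=
    sum_eq_zero fun j _ => if_neg fun h => by have := j.isLt; omega
  have h2 : ∑ j : Fin (K + 1), (if j = i then (if i.val < K then (1 - a i.val) * f (j, false) else 1 * f (j, false))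
      else 0) = f (i, false) := by
    rw [Finset.sum_ite_eq' univ i, if_pos (mem_univ _), if_neg hi, one_mul]
  rw [h1, h2, zero_add]

/-- Row of `(i,↓)`, `i ≥ 1`: `a_{i−1}·f(i−1,↓) + (1 − a_{i−1})·f(i,↑)`. [ours] -/
theorem sum_deoWalk_down (f : Fin (K + 1) × Bool → ℝ) (i : Fin (K + 1)) (hi : 0 < i.val) :
    ∑ y, deoWalk K a (i, false) y * f y
      = a (i.val - 1) * f (⟨i.val - 1, (Nat.sub_le i.val 1).trans_lt i.isLt⟩, false) + (1 - a (i.val - 1)) * f (i, true) := by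
  rw [Fintype.sum_prod_type]
  simp only [Fintype.sum_bool, deoWalk_down_up, deoWalk_down_down, sum_add_distrib, ite_mul, zero_mul]
  have h1 : ∑ j : Fin (K + 1), (if j = i then (if i.val = 0 then 1 * f (j, true) else (1 - a (i.val - 1)) * f (j, true))
      else 0) = (1 - a (i.val - 1)) * f (i, true) := by
    rw [Finset.sum_ite_eq' univ i, if_pos (mem_univ _), if_neg (by omega)]
  have h2 : ∑ j : Fin (K + 1), (if i.val = j.val + 1 then a j.val * f (j, false) else 0)
      = a (i.val - 1) * f (⟨i.val - 1, (Nat.sub_le i.val 1).trans_lt i.isLt⟩, false) := by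
    rw [Finset.sum_eq_single ⟨i.val - 1, (Nat.sub_le i.val 1).trans_lt i.isLt⟩
      (fun j _ hj => if_neg fun h => hj (Fin.ext (by simp only; omega))) (fun h => absurd (mem_univ _) h)]
    rw [if_pos (by simp only; omega)]
  rw [h1, h2, add_comm]

/-- Row of the bottom state `(0,↓)`: `f(0,↑)`. [ours] -/
theorem sum_deoWalk_bottom (f : Fin (K + 1) × Bool → ℝ) (i : Fin (K + 1)) (hi : i.val = 0) :
    ∑ y, deoWalk K a (i, false) y * f y = f (i, true) := by
  rw [Fintype.sum_prod_type]
  simp only [Fintype.sum_bool, deoWalk_down_up, deoWalk_down_down, sum_add_distrib, ite_mul, zero_mul]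
  have h1 : ∑ j : Fin (K + 1), (if j = i then (if i.val = 0 then 1 * f (j, true) else (1 - a (i.val - 1)) * f (j, true))
      else 0) = f (i, true) := by
    rw [Finset.sum_ite_eq' univ i, if_pos (mem_univ _), if_pos hi, one_mul]
  have h2 : ∑ j : Fin (K + 1), (if i.val = j.val + 1 then a j.val * f (j, false) else 0) = 0 :=
    sum_eq_zero fun j _ => if_neg fun h => by omega
  rw [h1, h2, add_zero]

/-- **The lifted walk is a transition matrix** for a profile in `[0, 1]`. [ours] -/
theorem deoWalk_isRowStochastic (ha0 : ∀ j, 0 ≤ a j) (ha1 : ∀ j, a j ≤ 1) :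
    IsRowStochastic (deoWalk K a) := by
  refine ⟨fun x y => ?_, fun x => ?_⟩
  · obtain ⟨i, b⟩ := x
    obtain ⟨j, c⟩ := y
    cases b <;> cases c
    · rw [deoWalk_down_down]; split_ifs <;> [exact ha0 _; exact le_rfl]
    · rw [deoWalk_down_up]
      have := ha1 (i.val - 1)
      split_ifs <;> linarith
    · rw [deoWalk_up_down]
      have := ha1 i.val
      split_ifs <;> linarith
    · rw [deoWalk_up_up]; split_ifs <;> [exact ha0 _; exact le_rfl]
  · obtain ⟨i, b⟩ := x
    have e : ∑ y, deoWalk K a (i, b) y = ∑ y, deoWalk K a (i, b) y * (fun _ => (1 : ℝ)) y := by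
      simp only [mul_one]
    rw [e]
    cases b
    · by_cases hi : 0 < i.val
      · rw [sum_deoWalk_down a _ i hi]; ring
      · rw [sum_deoWalk_bottom a _ i (by omega)]
    · by_cases hi : i.val < K
      · rw [sum_deoWalk_up a _ i hi]; ring
      · rw [sum_deoWalk_top a _ i hi]

end Walk

/-! ## §2 Passage times to the top -/

section Up

variable {K : ℕ} {a : ℕ → ℝ} {h : Fin (K + 1) × Bool → Fin (K + 1) × Bool → ℝ}

/-- The physical end, entered moving up: `⊤ = (K, ↑)`. [ours] -/
abbrev deoTop (K : ℕ) : Fin (K + 1) × Bool := (Fin.last K, true)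
/-- The open end, about to turn: `⊥ = (0, ↓)`. [ours] -/
abbrev deoBot (K : ℕ) : Fin (K + 1) × Bool := (0, false)

/-- **`h (i,↓) ⊤ = h (i,↑) ⊤ + (2i+1)`** (induction on `i` through the first-step equations). [ours] -/
theorem deo_down_eq_up_add (hh : IsHittingTimeSolution (deoWalk K a) h) (ha : ∀ j, a j ≠ 0) :
    ∀ (n : ℕ) (i : Fin (K + 1)), i.val = n →
      h (i, false) (deoTop K) = h (i, true) (deoTop K) + (2 * n + 1) := by
  intro n
  induction n with
  | zero =>
    intro i hi
    have hne : (i, false) ≠ deoTop K := fun e => Bool.false_ne_true (congrArg Prod.snd e)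
    rw [hh.2 _ _ hne, sum_deoWalk_bottom a _ i hi]
    push_cast
    ring
  | succ n ih =>
    intro i hi
    have hiK : n < K := by have := i.isLt; omega
    -- the predecessor `p = i − 1` (value `n`)
    set p : Fin (K + 1) := ⟨n, by omega⟩ with hp
    have hpv : p.val = n := rfl
    have ihp := ih p hpv
    -- first-step equation at `(p, ↑)` (not the top since `n < K`)
    have hne1 : (p, true) ≠ deoTop K := fun e => by
      have := congrArg (fun z => z.1.val) e
      simp only [Fin.val_last] at this
      omega
    have hsucc : (⟨p.val + 1, by omega⟩ : Fin (K + 1)) = i := Fin.ext (by simp only; omega)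
    have eq1 := hh.2 _ _ hne1
    rw [sum_deoWalk_up a _ p (by rw [hpv]; exact hiK), hsucc, ihp, hpv] at eq1
    -- first-step equation at `(i, ↓)`
    have hne2 : (i, false) ≠ deoTop K := fun e => Bool.false_ne_true (congrArg Prod.snd e)
    have hpred : (⟨i.val - 1, by omega⟩ : Fin (K + 1)) = p := Fin.ext (by simp only; omega)
    have eq2 := hh.2 _ _ hne2
    rw [sum_deoWalk_down a _ i (by omega), hpred, ihp, hi, Nat.add_sub_cancel] at eq2
    -- solve: from eq1, `a n · h(p,↑) = 1 + (1 − a n)(2n+1) + a n · h(i,↑)`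
    have han := ha n
    rw [eq2]
    push_cast
    -- eliminate `h (p, true)` using eq1
    have e3 : a n * h (p, true) (deoTop K) = 1 + (1 - a n) * (2 * n + 1) + a n * h (i, true) (deoTop K) := by
      linarith [eq1]
    have e4 : h (p, true) (deoTop K) = h (i, true) (deoTop K) + (1 + (1 - a n) * (2 * n + 1)) / a n := by
      field_simp
      linarith
    rw [e4]
    field_simp
    ring

/-- **One bond up costs `(1 + (2i+1)·r_i)/s_i` scans** (`i < K`). [ours] -/
theorem deo_up_step (hh : IsHittingTimeSolution (deoWalk K a) h) (ha : ∀ j, a j ≠ 0) (i : Fin (K + 1))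
    (hi : i.val < K) :
    h (i, true) (deoTop K) = h (⟨i.val + 1, Nat.succ_lt_succ hi⟩, true) (deoTop K)
      + (1 + (2 * (i.val : ℝ) + 1) * (1 - a i.val)) / a i.val := by
  have hne : (i, true) ≠ deoTop K := fun e => by
    have := congrArg (fun z => z.1.val) e
    simp only [Fin.val_last] at this
    omega
  have eq1 := hh.2 _ _ hne
  rw [sum_deoWalk_up a _ i hi, deo_down_eq_up_add hh ha i.val i rfl] at eq1
  have hai := ha i.val
  field_simp
  linarith [eq1]

/-- Telescoping: `h (i,↑) ⊤ = Σ_{j<d} (1 + (2(i+j)+1)(1 − a_{i+j}))/a_{i+j}` when `i + d = K`. [ours] -/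
theorem deo_up_time (hh : IsHittingTimeSolution (deoWalk K a) h) (ha : ∀ j, a j ≠ 0) :
    ∀ (d : ℕ) (i : Fin (K + 1)), i.val + d = K →
      h (i, true) (deoTop K)
        = ∑ j ∈ range d, (1 + (2 * ((i.val + j : ℕ) : ℝ) + 1) * (1 - a (i.val + j))) / a (i.val + j) := by
  intro d
  induction d with
  | zero =>
    intro i hi
    have e : (i, true) = deoTop K := by
      simp only [deoTop]; congr 1; exact Fin.ext (by rw [Fin.val_last]; omega)
    rw [e, hh.1, sum_range_zero]
  | succ d ih =>
    intro i hi
    have hiK : i.val < K := by omega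
    rw [deo_up_step hh ha i hiK, ih ⟨i.val + 1, by omega⟩ (by simp only; omega), sum_range_succ', add_zero]
    congr 1
    refine sum_congr rfl fun j _ => ?_
    have e : i.val + 1 + j = i.val + (j + 1) := by omega
    simp only [e]

/-- **THE DEO DELIVERY TIME `h ⊥ ⊤ = (K+1) + 2·Σ_{i<K} (i+1)·(1 − a_i)/a_i`** (Syed et al.'s
`a_↑^{0,−}`). [ours] -/
theorem deo_delivery_time (hh : IsHittingTimeSolution (deoWalk K a) h) (ha : ∀ j, a j ≠ 0) :
    h (deoBot K) (deoTop K) = ((K : ℝ) + 1) + 2 * ∑ i ∈ range K, ((i : ℝ) + 1) * (1 - a i) / a i := by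
  have h0 := deo_down_eq_up_add hh ha 0 0 rfl
  have h1 := deo_up_time hh ha K 0 (by simp)
  simp only [Fin.val_zero, zero_add, Nat.cast_zero, mul_zero] at h0 h1
  rw [deoBot, h0, h1]
  have e : ∀ i ∈ range K, (1 + (2 * (i : ℝ) + 1) * (1 - a i)) / a i = 1 + 2 * (((i : ℝ) + 1) * (1 - a i) / a i) := by
    intro i _
    have := ha i
    field_simp
    ring
  rw [sum_congr rfl e, sum_add_distrib, sum_const, card_range, nsmul_eq_mul, mul_one, ← mul_sum]
  ring

end Up

/-! ## §3 The return by reflection, and the round trip -/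

section RoundTrip

variable {K : ℕ} {a : ℕ → ℝ} {h : Fin (K + 1) × Bool → Fin (K + 1) × Bool → ℝ}

/-- The reflection `(i, b) ↦ (K − i, ¬b)` of the lifted state space. [ours] -/
def deoReflect (K : ℕ) : Fin (K + 1) × Bool ≃ Fin (K + 1) × Bool :=
  Equiv.prodCongr Fin.revPerm (Equiv.boolNot)

/-- `deoReflect K (i, b) = (Fin.rev i, !b)`. [ours] -/
theorem deoReflect_apply (i : Fin (K + 1)) (b : Bool) : deoReflect K (i, b) = (Fin.rev i, !b) := rfl
/-- **Reflection maps the lifted walk of profile `a` onto the lifted walk of the reversed profile**: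
`deoWalk K a (σ x) (σ y) = deoWalk K (revProfile K a) x y`. [ours] -/
theorem deoWalk_reflect (a : ℕ → ℝ) (x y : Fin (K + 1) × Bool) :
    deoWalk K a (deoReflect K x) (deoReflect K y) = deoWalk K (revProfile K a) x y := by
  obtain ⟨i, b⟩ := x
  obtain ⟨j, c⟩ := y
  have hi := i.isLt
  have hj := j.isLt
  have hvi : (Fin.rev i).val = K - i.val := by rw [Fin.val_rev]; omega
  have hvj : (Fin.rev j).val = K - j.val := by rw [Fin.val_rev]; omega
  simp only [deoReflect_apply]
  cases b <;> cases c <;>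
    simp only [Bool.not_false, Bool.not_true, deoWalk_up_up, deoWalk_up_down, deoWalk_down_up,
      deoWalk_down_down, revProfile_apply, hvi, hvj, Fin.rev_inj]
  · -- down,down ↦ up,up : `i = j+1` vs `K−j = K−i+1`
    by_cases hc : i.val = j.val + 1
    · rw [if_pos hc, if_pos (by omega)]
      congr 1; omega
    · rw [if_neg hc, if_neg (by omega)]
  · -- down,up ↦ up,down
    by_cases hc : j = i
    · subst hc
      rw [if_pos rfl, if_pos rfl]
      by_cases h0 : j.val = 0
      · rw [if_pos h0, if_neg (by omega)]
      · rw [if_neg h0, if_pos (by omega)]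
        congr 2; omega
    · rw [if_neg hc, if_neg hc]
  · -- up,down ↦ down,up
    by_cases hc : j = i
    · subst hc
      rw [if_pos rfl, if_pos rfl]
      by_cases hK : j.val < K
      · rw [if_pos hK, if_neg (by omega)]
        congr 2; omega
      · rw [if_neg hK, if_pos (by omega)]
    · rw [if_neg hc, if_neg hc]
  · -- up,up ↦ down,down
    by_cases hc : j.val = i.val + 1
    · rw [if_pos hc, if_pos (by omega)]
      congr 1; omega
    · rw [if_neg hc, if_neg (by omega)]

/-- **THE DEO RETURN TIME `h ⊤ ⊥ = (K+1) + 2·Σ_{i<K} (K−i)·(1 − a_i)/a_i`** (reflection transport). [ours] -/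
theorem deo_return_time (hh : IsHittingTimeSolution (deoWalk K a) h) (ha : ∀ j, a j ≠ 0) :
    h (deoTop K) (deoBot K) = ((K : ℝ) + 1) + 2 * ∑ i ∈ range K, ((K : ℝ) - i) * (1 - a i) / a i := by
  -- transport `h` to a solution for the reversed profile
  have hh' : IsHittingTimeSolution (deoWalk K (revProfile K a)) fun x y => h (deoReflect K x) (deoReflect K y) :=
    isHittingTimeSolution_comp_equiv_of_eq hh (deoReflect K) (fun x y => deoWalk_reflect a x y)
  have ha' : ∀ j, revProfile K a j ≠ 0 := fun j => ha _
  have key := deo_delivery_time hh' ha'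
  simp only [deoReflect_apply, deoBot, deoTop, Fin.rev_zero, Fin.rev_last, Bool.not_false, Bool.not_true] at key
  rw [deoTop, deoBot, key]
  congr 1
  congr 1
  rw [← Finset.sum_range_reflect (fun i => ((K : ℝ) - i) * (1 - a i) / a i) K]
  refine sum_congr rfl fun i hi => ?_
  have hiK := mem_range.1 hi
  have e : ((K - 1 - i : ℕ) : ℝ) = (K : ℝ) - 1 - i := by
    have h1 : (K - 1 - i : ℕ) + 1 + i = K := by omega
    have h2 := congrArg (fun n : ℕ => (n : ℝ)) h1
    push_cast at h2
    linarith
  rw [revProfile_apply, e]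
  ring

/-- **THE DEO ROUND TRIP (Syed–Bouchard-Côté–Deligiannidis–Doucet 2022, Thm 1):**
`h ⊥ ⊤ + h ⊤ ⊥ = 2(K+1) + 2(K+1)·Σ_{i<K} (1 − a_i)/a_i` scans. [ours] -/
theorem deo_round_trip (hh : IsHittingTimeSolution (deoWalk K a) h) (ha : ∀ j, a j ≠ 0) :
    h (deoBot K) (deoTop K) + h (deoTop K) (deoBot K)
      = 2 * ((K : ℝ) + 1) + 2 * ((K : ℝ) + 1) * ∑ i ∈ range K, (1 - a i) / a i := by
  rw [deo_delivery_time hh ha, deo_return_time hh ha]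
  have e : ∑ i ∈ range K, ((i : ℝ) + 1) * (1 - a i) / a i + ∑ i ∈ range K, ((K : ℝ) - i) * (1 - a i) / a i
      = ((K : ℝ) + 1) * ∑ i ∈ range K, (1 - a i) / a i := by
    rw [← sum_add_distrib, mul_sum]
    refine sum_congr rfl fun i _ => ?_
    ring
  linear_combination 2 * e

/-- **DEO = SEO − 2(K+1)(K−1)**: the DEO round trip is `2(K+1)·Σ_i 1/a_i − 2(K+1)(K−1)`, the reversible walk's
`profile_round_trip` minus a profile-free constant — the profile enters ONLY through `Σ_i 1/a_i`. [ours] -/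
theorem deo_round_trip_eq_seo_sub (hh : IsHittingTimeSolution (deoWalk K a) h) (ha : ∀ j, a j ≠ 0) :
    h (deoBot K) (deoTop K) + h (deoTop K) (deoBot K)
      = 2 * ((K : ℝ) + 1) * ∑ i ∈ range K, 1 / a i - 2 * ((K : ℝ) + 1) * ((K : ℝ) - 1) := by
  rw [deo_round_trip hh ha]
  have e : ∀ i ∈ range K, (1 - a i) / a i = 1 / a i - 1 := fun i _ => by
    have := ha i
    field_simp
  rw [sum_congr rfl e, sum_sub_distrib, sum_const, card_range, nsmul_eq_mul, mul_one]
  ring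

/-- **Flat profile `a`**: `2(K+1)·(1 + K(1−a)/a)` scans (one driver `swap_step` = two scans). [ours] -/
theorem deo_round_trip_const {a : ℝ} (ha : a ≠ 0)
    {h : Fin (K + 1) × Bool → Fin (K + 1) × Bool → ℝ} (hh : IsHittingTimeSolution (deoWalk K (fun _ => a)) h) :
    h (deoBot K) (deoTop K) + h (deoTop K) (deoBot K) = 2 * ((K : ℝ) + 1) * (1 + K * (1 - a) / a) := by
  rw [deo_round_trip hh (fun _ => ha), sum_const, card_range, nsmul_eq_mul]
  ring

end RoundTrip

end Summit.Ventures.LatticeQCDFlow.Scaling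

end
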